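import Literature.AlgebraicGeometry.GroupSchemes.BarsottiTateGroupFixedPart
import Literature.AlgebraicGeometry.Morphisms.FiniteFlatRankComp
import HarnessLib

/-!
# The height of the fixed part of an idempotent endomorphism of a Barsotti–Tate group; the splitting theorem

Topic `Literature/AlgebraicGeometry/GroupSchemes`; namespace `Literature.AlgebraicGeometry.GroupSchemes.BTGroup(.Hom)`.  THEOREMS ONLY
(no definition, no named fact, no instance, no notation, no `sorry`).  Cell `hodgecm-mathlib` (D-0151), FLOOR 0, P6 «MOD programme»,
organ of the P6b line's `stub_L42_idempotentSplitting` (σ2): the HEIGHT clause and the final assembly, over ★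
`GroupSchemes/BarsottiTateGroupFixedPart` (the layers `Fix ε_n`, all of Tate's axioms but the order count, the assembly `fixBTGroup`
from a rank function), ★ `GroupSchemes/IdempotentSplittingFiniteFlat` (`G_n ≅ Fix ε_n ⊗ Ker ε_n`) and ★ `Morphisms/FiniteFlatRankComp`
(rank of a composite ∕ of a fibre product ∕ constancy over a local base).  `--supports stmt-HodgeConjecture-24832`; COUNT-NEUTRAL: HC_CM
is proved only modulo the 7 printed citations until rung 0 closes; this file discharges none of them.

THE PRINT.  [Tate1967] §2 (2.1)–(2.2): in a `p`-divisible group `(G_ν)` of height `h` the orders are `|G_ν| = p^{νh}`, forced by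
`|G_1| = p^h` and the exact sequences `0 → G_1 → G_{ν+1} →(j) G_ν → 0`; for the fixed part of an idempotent `ε` (the factor `εG` of
`G = εG × (1−ε)G`, [RapoportSmithlingZhang2020Diagonal] §4.1 p. 17 «(dec pdiv)» `A[p^∞] = ∏_w A[w^∞]`) the order of `Fix ε_1` divides
`p^h`, so it is `p^{h₁}` AS SOON AS `p` IS PRIME, and the same exact sequences give `|Fix ε_ν| = p^{ν h₁}`.  In the tree's pointwise-rank
currency (`Scheme.Hom.finrank`): `rk Fix ε_n · rk Ker ε_n = p^{nh}` (product formula), the restricted `[p]`-map `Fix ε_{n+1} → Fix ε_n`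
has rank `rk Ker` at every point (shear isomorphism `K' ×_K K' ≅ Ker ⊗ K'` + base change), the kernels `Ker(Fix ε_{n+1} → Fix ε_n)`
are isomorphic for all `n` (they are all `Fix ε_1`), and the composite formula gives `rk Fix ε_{n+1} = rk Ker · rk Fix ε_n`; over a
LOCAL base ranks are constant, whence `h₁`.

WHAT IS HERE (`B : BTGroup S p h`, `ε : BTGroup.Hom B B` idempotent):
* §4 `finrank_fixLayer_mul_finrank_ker` (`rk_s Fix ε_n · rk_s Ker ε_n = p^{nh}`), `exists_shearIso` (`K' ×_K K' ≅ Ker π ⊗ K'` for a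
  homomorphism `π` of group objects of `Over S`), **`finrank_fixPMap_left`** (the restricted `[p]`-map has the rank of its kernel);
* §5 `incl_comp_pMap` (`incl ≫ pMap = [p]`), `fixIncl_comp_fixPMap`, **`nonempty_iso_ker_fixPMap`** (`Ker(Fix ε_{n+1} → Fix ε_n) ≅
  Ker(Fix ε_{n+2} → Fix ε_{n+1})`), `finrank_ker_fixPMap_eq` (all kernels have the rank of the first);
* §6 `finrank_fixLayer_succ`, `finrank_fixLayer_eq_pow` (`rk_s Fix ε_n = c_s^n`), **`exists_finrank_fixLayer_eq_pow`** (over `Spec A`,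
  `A` LOCAL, `p` PRIME: `∃ h₁, ∀ n s, rk_s Fix ε_n = p^{n h₁}`);
* §7 **`exists_btGroup_hom_of_idempotent`** — THE SPLITTING THEOREM: over `Spec A`, `A` local, `p` prime, an idempotent endomorphism `ε`
  of a Barsotti–Tate group `B` admits a Barsotti–Tate group `B₁ = Fix ε` of some height `h₁` with a homomorphism `j : B₁ → B` whose
  layers are closed immersions, `j ≫ ε = j`, universal for `ε`-fixed points (the text of the P6b line's `stub_L42_idempotentSplitting`).

## References
* [Tate1967] J. T. Tate, *p-divisible groups*, Proc. Conf. Local Fields (Driebergen 1966), Springer 1967 — §2, (2.1)–(2.2).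
* [RapoportSmithlingZhang2020Diagonal] M. Rapoport, B. Smithling, W. Zhang, *Arithmetic diagonal cycles on unitary Shimura varieties*,
  Compos. Math. 156 (2020) — §4.1 (p. 17).
* [GortzWedhorn2020] U. Görtz, T. Wedhorn, *Algebraic Geometry I*, 2nd ed. (2020) — Definition 4.45 (2) (p. 117); Proposition 12.13.
-/

noncomputable section

universe u

open CategoryTheory CategoryTheory.Limits AlgebraicGeometry MonoidalCategory CartesianMonoidalCategory
open scoped MonObj

namespace Literature.AlgebraicGeometry.GroupSchemes

namespace BTGroup

namespace Hom

variable {S : Scheme.{u}} {p h : ℕ} {B : BTGroup S p h} (ε : Hom B B)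

/-! ## §4 Ranks: `rk Fix ε_n · rk Ker ε_n = p^{nh}`; the restricted `p`-map has the rank of its kernel -/

/-- **`rk_s (Fix ε_n) · rk_s (Ker ε_n) = p^{nh}`**: the splitting `G_n ≅ Fix ε_n ⊗ Ker ε_n` (★ `IdempotentSplitting.splitIso`), the
product formula (★ `Morphisms.finrank_tensorObj_hom`) and Tate's order count `rk_s G_n = p^{nh}`. [cite: Tate1967, §2 (2.1)]
[cite: GortzWedhorn2020, Proposition 12.13] -/
theorem finrank_fixLayer_mul_finrank_ker (hε : ∀ n, ε.app n ≫ ε.app n = ε.app n) (n : ℕ) (s : S) :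
    letI := B.grpObj n
    (ε.fixLayer n).hom.finrank s * (GroupSchemeKernel.ker (ε.app n)).hom.finrank s = p ^ (n * h) := by
  letI := B.grpObj n
  haveI := B.comm n
  haveI := ε.isMonHom_app n
  haveI : IsFinite (B.G n).hom := B.isFinite n
  haveI : Flat (B.G n).hom := B.flat n
  haveI : IsFinite (ε.fixLayer n).hom := ε.isFinite_fixLayer_hom n
  haveI : Flat (ε.fixLayer n).hom := ε.flat_fixLayer_hom hε n
  haveI : IsFinite (GroupSchemeKernel.ker (ε.app n)).hom := IdempotentSplitting.isFinite_ker_hom (ε.app n)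
  haveI : Flat (GroupSchemeKernel.ker (ε.app n)).hom := IdempotentSplitting.flat_ker_hom (ε.app n) (hε n)
  let e := IdempotentSplitting.splitIso (ε.app n) (hε n)
  haveI : IsIso e.hom.left := (inferInstance : IsIso ((Over.forget S).map e.hom))
  have hXY : IsPullback (fst (ε.fixLayer n) (GroupSchemeKernel.ker (ε.app n))).left
      (snd (ε.fixLayer n) (GroupSchemeKernel.ker (ε.app n))).left (ε.fixLayer n).hom
      (GroupSchemeKernel.ker (ε.app n)).hom := IsPullback.of_hasPullback _ _
  haveI : IsFinite (snd (ε.fixLayer n) (GroupSchemeKernel.ker (ε.app n))).left :=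
    MorphismProperty.of_isPullback (P := @IsFinite) hXY inferInstance
  haveI : Flat (snd (ε.fixLayer n) (GroupSchemeKernel.ker (ε.app n))).left :=
    MorphismProperty.of_isPullback (P := @Flat) hXY inferInstance
  haveI : IsFinite (ε.fixLayer n ⊗ GroupSchemeKernel.ker (ε.app n)).hom := by
    rw [← Over.w (snd (ε.fixLayer n) (GroupSchemeKernel.ker (ε.app n)))]; infer_instance
  haveI : Flat (ε.fixLayer n ⊗ GroupSchemeKernel.ker (ε.app n)).hom := by
    rw [← Over.w (snd (ε.fixLayer n) (GroupSchemeKernel.ker (ε.app n)))]; infer_instance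
  rw [mul_comm, ← Morphisms.finrank_tensorObj_hom, ← B.finrank_eq n s, ← Over.w e.hom,
    Scheme.Hom.finrank_comp_left_of_isIso]

/-- **The shear isomorphism** `K' ×_K K' ≅ Ker π ⊗ K'`, `(a, b) ↦ (a b⁻¹, b)`, for a homomorphism `π : K' → K` of group objects of
`Over S` (compatible with the second projections); stated as an existence so that this file declares no data.
[cite: GortzWedhorn2020, Definition 4.45 (2), p. 117] -/
theorem exists_shearIso {K K' : Over S} [GrpObj K] [GrpObj K'] (π : K' ⟶ K) [IsMonHom π] :
    ∃ e : pullback π π ≅ GroupSchemeKernel.ker π ⊗ K', e.hom ≫ snd _ _ = pullback.snd π π := by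
  refine ⟨⟨lift (GroupSchemeKernel.kerLift (pullback.fst π π / pullback.snd π π)
      (by rw [GrpObj.div_comp, pullback.condition, div_self'])) (pullback.snd π π),
    pullback.lift ((fst _ _ ≫ GroupSchemeKernel.kerι π) * snd _ _) (snd _ _)
      (by rw [MonObj.mul_comp, Category.assoc, GroupSchemeKernel.kerι_comp, MonObj.comp_one, one_mul]), ?_, ?_⟩, lift_snd _ _⟩
  · apply pullback.hom_ext
    · simp only [Category.assoc, Category.id_comp, pullback.lift_fst, MonObj.comp_mul, lift_fst_assoc,
        GroupSchemeKernel.kerLift_ι, lift_snd, div_mul_cancel]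
    · simp only [Category.assoc, pullback.lift_snd, lift_snd, Category.id_comp]
  · apply CartesianMonoidalCategory.hom_ext
    · apply GroupSchemeKernel.ker_hom_ext
      simp only [Category.assoc, Category.id_comp, lift_fst_assoc, GroupSchemeKernel.kerLift_ι, GrpObj.comp_div,
        pullback.lift_fst, pullback.lift_snd, mul_div_cancel_right]
    · simp only [Category.assoc, lift_snd, pullback.lift_snd, Category.id_comp]

/-- **The restricted `[p]`-map `π : Fix ε_{n+1} → Fix ε_n` has, at every point of its image, the rank of its kernel**:
`rk_{π x} π = rk_{s(x)} (Ker π → S)` — base change of `π` along itself is `K' ×_K K' ≅ Ker π ⊗ K' → K'` (shear), a base change of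
`Ker π → S` (Mathlib `finrank_of_isPullback`). [cite: Tate1967, §2 (2.1)] [cite: GortzWedhorn2020, Proposition 12.13] -/
theorem finrank_fixPMap_left (hε : ∀ n, ε.app n ≫ ε.app n = ε.app n) (n : ℕ) (x : (ε.fixLayer (n + 1)).left) :
    letI := ε.fixLayerGrpObj n
    (ε.fixPMap n).left.finrank ((ε.fixPMap n).left x) =
      (GroupSchemeKernel.ker (ε.fixPMap n)).hom.finrank ((ε.fixLayer (n + 1)).hom x) := by
  letI := ε.fixLayerGrpObj n
  letI := ε.fixLayerGrpObj (n + 1)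
  haveI := ε.isMonHom_fixPMap n
  haveI : Flat (ε.fixPMap n).left := ε.flat_fixPMap_left hε n
  haveI : IsFinite (ε.fixPMap n).left := ε.isFinite_fixPMap_left n
  let π := ε.fixPMap n
  have hQ : IsPullback (pullback.fst π π).left (pullback.snd π π).left π.left π.left :=
    (IsPullback.of_hasPullback π π).map (Over.forget S)
  rw [← Scheme.Hom.finrank_of_isPullback _ _ _ _ hQ x]
  -- `Ker π → S` is finite flat: base change of `π` along the unit section, then `𝟙_ → S`
  have hk : IsPullback (GroupSchemeKernel.kerι π).left (pullback.snd π η[ε.fixLayer n]).left π.left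
      (η[ε.fixLayer n] : 𝟙_ (Over S) ⟶ ε.fixLayer n).left := GroupSchemeKernel.isPullback_kerι_left π
  haveI : IsIso (𝟙_ (Over S)).hom := (inferInstance : IsIso (𝟙 S))
  haveI : IsFinite (pullback.snd π η[ε.fixLayer n]).left := MorphismProperty.of_isPullback (P := @IsFinite) hk inferInstance
  haveI : Flat (pullback.snd π η[ε.fixLayer n]).left := MorphismProperty.of_isPullback (P := @Flat) hk inferInstance
  haveI : IsFinite (GroupSchemeKernel.ker π).hom := by
    change IsFinite (pullback π η[ε.fixLayer n]).hom
    rw [← Over.w (pullback.snd π η[ε.fixLayer n])]; infer_instance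
  haveI : Flat (GroupSchemeKernel.ker π).hom := by
    change Flat (pullback π η[ε.fixLayer n]).hom
    rw [← Over.w (pullback.snd π η[ε.fixLayer n])]; infer_instance
  -- `Ker π ⊗ K' → K'` is the base change of `Ker π → S`
  have hsq : IsPullback (fst (GroupSchemeKernel.ker π) (ε.fixLayer (n + 1))).left
      (snd (GroupSchemeKernel.ker π) (ε.fixLayer (n + 1))).left (GroupSchemeKernel.ker π).hom (ε.fixLayer (n + 1)).hom :=
    IsPullback.of_hasPullback _ _
  haveI : Flat (snd (GroupSchemeKernel.ker π) (ε.fixLayer (n + 1))).left :=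
    MorphismProperty.of_isPullback (P := @Flat) hsq inferInstance
  haveI : IsFinite (snd (GroupSchemeKernel.ker π) (ε.fixLayer (n + 1))).left :=
    MorphismProperty.of_isPullback (P := @IsFinite) hsq inferInstance
  obtain ⟨e, he⟩ := exists_shearIso π
  haveI : IsIso e.hom.left := (inferInstance : IsIso ((Over.forget S).map e.hom))
  have hsnd : (pullback.snd π π).left = e.hom.left ≫ (snd (GroupSchemeKernel.ker π) (ε.fixLayer (n + 1))).left := by
    rw [← Over.comp_left, he]
  rw [hsnd, Scheme.Hom.finrank_comp_left_of_isIso, Scheme.Hom.finrank_of_isPullback _ _ _ _ hsq x]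

/-! ## §5 The kernels of the restricted `p`-maps are all isomorphic -/

/-- In a Barsotti–Tate group `incl n ≫ pMap n = [p]` on `G_n` (test after the monomorphism `incl n`: `pMap ≫ incl = [p]`).
[cite: Tate1967, §2 (2.1)] -/
theorem _root_.Literature.AlgebraicGeometry.GroupSchemes.BTGroup.incl_comp_pMap (B : BTGroup S p h) (m : ℕ) :
    letI := B.grpObj m
    B.incl m ≫ B.pMap m = (𝟙 (B.G m) : B.G m ⟶ B.G m) ^ p := by
  letI := B.grpObj m
  letI := B.grpObj (m + 1)
  haveI := B.mono_incl m
  haveI := B.incl_isMonHom m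
  rw [← cancel_mono (B.incl m), Category.assoc, B.pMap_incl m, MonObj.comp_pow, Category.comp_id, MonObj.pow_comp,
    Category.id_comp]

/-- On the fixed part, `fixIncl m ≫ fixPMap m = [p]` on `Fix ε_m`. [cite: Tate1967, §2 (2.1)] -/
theorem fixIncl_comp_fixPMap (m : ℕ) :
    letI := ε.fixLayerGrpObj m
    ε.fixIncl m ≫ ε.fixPMap m = (𝟙 (ε.fixLayer m) : ε.fixLayer m ⟶ ε.fixLayer m) ^ p := by
  letI := B.grpObj m
  letI := B.grpObj (m + 1)
  haveI := B.comm m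
  haveI := ε.isMonHom_app m
  letI := ε.fixLayerGrpObj m
  haveI := ε.isMonHom_fixLayerι m
  haveI := ε.mono_fixLayerι m
  rw [← cancel_mono (ε.fixLayerι m), Category.assoc, fixPMap_ι, fixIncl_ι_assoc, B.incl_comp_pMap m,
    MonObj.pow_comp, Category.id_comp, MonObj.comp_pow, Category.comp_id]

/-- The transitions and the `[p]`-maps of the fixed part commute: `fixIncl (n+1) ≫ fixPMap (n+1) = fixPMap n ≫ fixIncl n` (both are `[p]`).
[cite: Tate1967, §2 (2.1)] -/
theorem fixIncl_comp_fixPMap_eq_fixPMap_comp_fixIncl (n : ℕ) :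
    ε.fixIncl (n + 1) ≫ ε.fixPMap (n + 1) = ε.fixPMap n ≫ ε.fixIncl n := by
  rw [fixIncl_comp_fixPMap, fixPMap_incl]

/-- **All the kernels `Ker(Fix ε_{n+1} → Fix ε_n)` are isomorphic**: `Ker(π_n) ≅ Ker(π_{n+1})` — forward by the transition
`Fix ε_{n+1} → Fix ε_{n+2}`; backward because a point of `Fix ε_{n+2}` killed by `π_{n+1}` is killed by `p`, hence by `p^{n+1}`, so
lies in `G_{n+1} = G_{n+2}[p^{n+1}]` (Tate's kernel square), is `ε`-fixed, and is killed by `π_n` (`incl` is a monomorphism).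
[cite: Tate1967, §2 (2.1)] -/
theorem nonempty_iso_ker_fixPMap (n : ℕ) :
    letI := ε.fixLayerGrpObj n
    letI := ε.fixLayerGrpObj (n + 1)
    Nonempty (GroupSchemeKernel.ker (ε.fixPMap n) ≅ GroupSchemeKernel.ker (ε.fixPMap (n + 1))) := by
  letI := B.grpObj n
  letI := B.grpObj (n + 1)
  letI := B.grpObj (n + 2)
  haveI := B.comm (n + 1)
  haveI := B.comm (n + 2)
  haveI := ε.isMonHom_app (n + 1)
  haveI := ε.isMonHom_app (n + 2)
  letI := ε.fixLayerGrpObj n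
  letI := ε.fixLayerGrpObj (n + 1)
  letI := ε.fixLayerGrpObj (n + 2)
  haveI := ε.isMonHom_fixLayerι (n + 1)
  haveI := ε.isMonHom_fixLayerι (n + 2)
  haveI := ε.mono_fixLayerι (n + 1)
  haveI := ε.mono_fixLayerι (n + 2)
  haveI := ε.isMonHom_fixIncl n
  haveI := ε.isMonHom_fixPMap (n + 1)
  haveI := B.mono_incl (n + 1)
  haveI := B.incl_isMonHom (n + 1)
  -- `u : Ker π_n → Ker π_{n+1}` induced by the transition `Fix ε_{n+1} → Fix ε_{n+2}`
  have hu : (GroupSchemeKernel.kerι (ε.fixPMap n) ≫ ε.fixIncl (n + 1)) ≫ ε.fixPMap (n + 1) = 1 := by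
    rw [Category.assoc, fixIncl_comp_fixPMap_eq_fixPMap_comp_fixIncl, ← Category.assoc, GroupSchemeKernel.kerι_comp,
      MonObj.one_comp]
  -- `v : Ker π_{n+1} → Ker π_n`: a point of `Fix ε_{n+2}` killed by `π_{n+1}` is killed by `p`, hence by `p^{n+1}`, so lies in
  -- `G_{n+1} = G_{n+2}[p^{n+1}]`, is `ε`-fixed, and is killed by `π_n`
  let t : GroupSchemeKernel.ker (ε.fixPMap (n + 1)) ⟶ B.G (n + 2) :=
    GroupSchemeKernel.kerι (ε.fixPMap (n + 1)) ≫ ε.fixLayerι (n + 2)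
  have htp : t ^ p = 1 := by
    calc t ^ p = t ≫ (𝟙 (B.G (n + 2))) ^ p := by rw [MonObj.comp_pow, Category.comp_id]
      _ = 1 := by
        rw [← B.pMap_incl (n + 1), Category.assoc, ← Category.assoc (ε.fixLayerι (n + 2)), ← fixPMap_ι,
          Category.assoc, ← Category.assoc (GroupSchemeKernel.kerι _), GroupSchemeKernel.kerι_comp, MonObj.one_comp]
  have ht : t ≫ (𝟙 (B.G (n + 2))) ^ (p ^ (n + 1)) = toUnit _ ≫ η[B.G (n + 2)] := by
    rw [MonObj.comp_pow, Category.comp_id, pow_succ', pow_mul, htp, one_pow, Hom.one_def]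
  let w : GroupSchemeKernel.ker (ε.fixPMap (n + 1)) ⟶ B.G (n + 1) := (B.isPullback_incl (n + 1)).lift t (toUnit _) ht
  have hw : w ≫ B.incl (n + 1) = t := IsPullback.lift_fst _ _ _ _
  have hwε : w ≫ ε.app (n + 1) = w := by
    rw [← cancel_mono (B.incl (n + 1)), Category.assoc, ← ε.incl_comp_app (n + 1), ← Category.assoc, hw, Category.assoc,
      fixLayerι_comp]
  have hwp : w ^ p = 1 := by
    rw [← cancel_mono (B.incl (n + 1)), MonObj.pow_comp, hw, htp, MonObj.one_comp]
  let w' : GroupSchemeKernel.ker (ε.fixPMap (n + 1)) ⟶ ε.fixLayer (n + 1) := IdempotentSplitting.fixLift (ε.app (n + 1)) w hwε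
  have hw' : w' ≫ ε.fixLayerι (n + 1) = w := IdempotentSplitting.fixLift_ι _ _ _
  have hv : w' ≫ ε.fixPMap n = 1 := by
    haveI := ε.mono_fixLayerι n
    haveI := B.mono_incl n
    haveI := ε.isMonHom_fixLayerι n
    haveI := B.incl_isMonHom n
    letI := B.grpObj n
    haveI := B.comm n
    haveI := ε.isMonHom_app n
    rw [← cancel_mono (ε.fixLayerι n), ← cancel_mono (B.incl n), Category.assoc, Category.assoc, fixPMap_ι_assoc,
      B.pMap_incl n, ← Category.assoc, hw', MonObj.comp_pow, Category.comp_id, hwp, MonObj.one_comp, MonObj.one_comp]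
  refine ⟨⟨GroupSchemeKernel.kerLift _ hu, GroupSchemeKernel.kerLift w' hv, ?_, ?_⟩⟩
  · apply GroupSchemeKernel.ker_hom_ext
    rw [← cancel_mono (ε.fixLayerι (n + 1)), ← cancel_mono (B.incl (n + 1))]
    simp only [Category.assoc, Category.id_comp, GroupSchemeKernel.kerLift_ι_assoc]
    rw [reassoc_of% hw', hw]
    change _ ≫ GroupSchemeKernel.kerι (ε.fixPMap (n + 1)) ≫ ε.fixLayerι (n + 2) = _
    rw [GroupSchemeKernel.kerLift_ι_assoc, Category.assoc, fixIncl_ι]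
  · apply GroupSchemeKernel.ker_hom_ext
    rw [← cancel_mono (ε.fixLayerι (n + 2))]
    simp only [Category.assoc, Category.id_comp, GroupSchemeKernel.kerLift_ι_assoc]
    rw [fixIncl_ι, reassoc_of% hw', hw]

/-- `Ker(Fix ε_{n+1} → Fix ε_n) → S` is finite and flat (base change of the finite flat restricted `[p]`-map along the unit section).
[cite: Tate1967, §2 (2.1)] -/
theorem isFinite_ker_fixPMap_hom (hε : ∀ n, ε.app n ≫ ε.app n = ε.app n) (n : ℕ) :
    letI := ε.fixLayerGrpObj n
    IsFinite (GroupSchemeKernel.ker (ε.fixPMap n)).hom ∧ Flat (GroupSchemeKernel.ker (ε.fixPMap n)).hom := by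
  letI := ε.fixLayerGrpObj n
  haveI : Flat (ε.fixPMap n).left := ε.flat_fixPMap_left hε n
  haveI : IsFinite (ε.fixPMap n).left := ε.isFinite_fixPMap_left n
  let π := ε.fixPMap n
  have hk : IsPullback (GroupSchemeKernel.kerι π).left (pullback.snd π η[ε.fixLayer n]).left π.left
      (η[ε.fixLayer n] : 𝟙_ (Over S) ⟶ ε.fixLayer n).left := GroupSchemeKernel.isPullback_kerι_left π
  haveI : IsIso (𝟙_ (Over S)).hom := (inferInstance : IsIso (𝟙 S))
  haveI : IsFinite (pullback.snd π η[ε.fixLayer n]).left := MorphismProperty.of_isPullback (P := @IsFinite) hk inferInstance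
  haveI : Flat (pullback.snd π η[ε.fixLayer n]).left := MorphismProperty.of_isPullback (P := @Flat) hk inferInstance
  constructor
  · change IsFinite (pullback π η[ε.fixLayer n]).hom
    rw [← Over.w (pullback.snd π η[ε.fixLayer n])]; infer_instance
  · change Flat (pullback π η[ε.fixLayer n]).hom
    rw [← Over.w (pullback.snd π η[ε.fixLayer n])]; infer_instance

/-- All the kernels `Ker(Fix ε_{n+1} → Fix ε_n)` have the same rank at `s` (they are isomorphic over `S`). [cite: Tate1967, §2 (2.1)] -/
theorem finrank_ker_fixPMap_eq (hε : ∀ n, ε.app n ≫ ε.app n = ε.app n) (n : ℕ) (s : S) :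
    (letI := ε.fixLayerGrpObj n; (GroupSchemeKernel.ker (ε.fixPMap n)).hom.finrank s) =
      (letI := ε.fixLayerGrpObj 0; (GroupSchemeKernel.ker (ε.fixPMap 0)).hom.finrank s) := by
  induction n with
  | zero => rfl
  | succ n ih =>
    rw [← ih]
    letI := ε.fixLayerGrpObj n
    letI := ε.fixLayerGrpObj (n + 1)
    obtain ⟨e⟩ := ε.nonempty_iso_ker_fixPMap n
    haveI : IsIso e.hom.left := (inferInstance : IsIso ((Over.forget S).map e.hom))
    haveI := (ε.isFinite_ker_fixPMap_hom hε (n + 1)).1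
    haveI := (ε.isFinite_ker_fixPMap_hom hε (n + 1)).2
    rw [← Over.w e.hom, Scheme.Hom.finrank_comp_left_of_isIso]

/-! ## §6 The height: over a local base the ranks of the `Fix ε_n` are `p^{n h₁}` -/

/-- **`rk_s Fix ε_{n+1} = rk_s Ker · rk_s Fix ε_n`** — the composite formula (★ `Morphisms.finrank_comp_eq_mul`) for
`Fix ε_{n+1} →(π_n) Fix ε_n → S`, `π_n` having the constant rank `rk_s Ker` on the fibre (surjective, `finrank_fixPMap_left`,
`finrank_ker_fixPMap_eq`); Tate's `|G_{ν+1}| = |G_1| · |G_ν|`. [cite: Tate1967, §2 (2.1)] [cite: GortzWedhorn2020, Proposition 12.13] -/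
theorem finrank_fixLayer_succ (hε : ∀ n, ε.app n ≫ ε.app n = ε.app n) (n : ℕ) (s : S) :
    (ε.fixLayer (n + 1)).hom.finrank s =
      (letI := ε.fixLayerGrpObj 0; (GroupSchemeKernel.ker (ε.fixPMap 0)).hom.finrank s) *
        (ε.fixLayer n).hom.finrank s := by
  letI := ε.fixLayerGrpObj n
  haveI : Flat (ε.fixPMap n).left := ε.flat_fixPMap_left hε n
  haveI : IsFinite (ε.fixPMap n).left := ε.isFinite_fixPMap_left n
  haveI : Flat (ε.fixLayer n).hom := ε.flat_fixLayer_hom hε n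
  haveI : IsFinite (ε.fixLayer n).hom := ε.isFinite_fixLayer_hom n
  haveI : Surjective (ε.fixPMap n).left := ε.surjective_fixPMap_left hε n
  rw [← ε.finrank_ker_fixPMap_eq hε n s, ← Over.w (ε.fixPMap n)]
  refine Morphisms.finrank_comp_eq_mul (ε.fixPMap n).left (ε.fixLayer n).hom s _ (fun y hy => ?_)
  obtain ⟨x, rfl⟩ := (ε.fixPMap n).left.surjective y
  rw [ε.finrank_fixPMap_left hε n x, ← hy, ← Scheme.Hom.comp_apply, Over.w]

/-- `rk_s Fix ε_n = c_s ^ n` with `c_s` the common rank of the kernels (`rk_s Fix ε_0 = 1` as a factor of `rk_s G_0 = 1`).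
[cite: Tate1967, §2 (2.1)] -/
theorem finrank_fixLayer_eq_pow (hε : ∀ n, ε.app n ≫ ε.app n = ε.app n) (n : ℕ) (s : S) :
    (ε.fixLayer n).hom.finrank s =
      (letI := ε.fixLayerGrpObj 0; (GroupSchemeKernel.ker (ε.fixPMap 0)).hom.finrank s) ^ n := by
  induction n with
  | zero =>
    have h0 := ε.finrank_fixLayer_mul_finrank_ker hε 0 s
    rw [zero_mul, pow_zero] at h0
    rw [pow_zero]
    exact Nat.eq_one_of_mul_eq_one_right h0
  | succ n ih => rw [ε.finrank_fixLayer_succ hε n s, ih, pow_succ, mul_comm]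

/-- **THE HEIGHT OF THE FIXED PART**: over `Spec A` with `A` LOCAL and `p` PRIME there is `h₁` with `rk_s (Fix ε_n) = p^{n h₁}` for all
`n` and all points `s` — `c = rk Fix ε_1` divides `rk G_1 = p^h`, so `c = p^{h₁}` (`Nat.dvd_prime_pow`); ranks over a local base do
not depend on the point (★ `Morphisms.finrank_eq_finrank_of_isLocalRing`).  For composite `p` this fails (the CRT idempotent of
`μ_{6^∞}` splits off `μ_{2^∞}`). [cite: Tate1967, §2 (2.1)] [cite: RapoportSmithlingZhang2020Diagonal, §4.1 (p. 17)] -/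
theorem exists_finrank_fixLayer_eq_pow {A : Type u} [CommRing A] [IsLocalRing A] (hp : p.Prime)
    {B : BTGroup (Spec (.of A)) p h} (ε : Hom B B) (hε : ∀ n, ε.app n ≫ ε.app n = ε.app n) :
    ∃ h₁ : ℕ, ∀ (n : ℕ) (s : Spec (.of A)), (ε.fixLayer n).hom.finrank s = p ^ (n * h₁) := by
  let s₀ : Spec (.of A) := IsLocalRing.closedPoint A
  letI := ε.fixLayerGrpObj 0
  -- the common rank `c` of the kernels divides `p^h` (it is the rank of `Fix ε_1`, a factor of `rk G_1 = p^h`)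
  have hc : (GroupSchemeKernel.ker (ε.fixPMap 0)).hom.finrank s₀ ∣ p ^ h := by
    have h1 := ε.finrank_fixLayer_mul_finrank_ker hε 1 s₀
    rw [ε.finrank_fixLayer_eq_pow hε 1 s₀, pow_one, one_mul] at h1
    exact Dvd.intro _ h1
  obtain ⟨h₁, -, hch⟩ := (Nat.dvd_prime_pow hp).1 hc
  refine ⟨h₁, fun n s => ?_⟩
  haveI : Flat (ε.fixLayer n).hom := ε.flat_fixLayer_hom hε n
  haveI : IsFinite (ε.fixLayer n).hom := ε.isFinite_fixLayer_hom n
  rw [Morphisms.finrank_eq_finrank_of_isLocalRing (ε.fixLayer n).hom s s₀, ε.finrank_fixLayer_eq_pow hε n s₀, hch, ← pow_mul,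
    mul_comm]

end Hom

/-! ## §7 The splitting theorem -/

/-- **THE SPLITTING THEOREM (an idempotent endomorphism of a Barsotti–Tate group over a local base splits off a Barsotti–Tate
group).**  Over `Spec A`, `A` a LOCAL ring, `p` PRIME, let `B` be a Barsotti–Tate group of height `h` and `ε : B → B` an idempotent
endomorphism (`ε_n ≫ ε_n = ε_n`).  Then there are `h₁`, a Barsotti–Tate group `B₁` of height `h₁` (namely `Fix ε`, ★ `fixBTGroup` with
the rank function of `exists_finrank_fixLayer_eq_pow`) and a homomorphism `j : B₁ → B` whose layers are closed immersions, with
`j_n ≫ ε_n = j_n`, UNIVERSAL: every `T`-valued point of `G_n` fixed by `ε_n` factors uniquely through `j_n` — the group-scheme half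
of `A[p^∞] = ∏_{w ∣ p} A[w^∞]`.  This is the text of the P6b line's `stub_L42_idempotentSplitting`. [cite: Tate1967, §2 (2.1)–(2.2)]
[cite: RapoportSmithlingZhang2020Diagonal, §4.1 (p. 17)] -/
theorem exists_btGroup_hom_of_idempotent :
    ∀ (p : ℕ), p.Prime → ∀ (A : Type u) [CommRing A] [IsLocalRing A] (h : ℕ) (B : BTGroup (Spec (.of A)) p h)
      (ε : BTGroup.Hom B B), (∀ n, ε.app n ≫ ε.app n = ε.app n) →
      ∃ (h₁ : ℕ) (B₁ : BTGroup (Spec (.of A)) p h₁) (j : BTGroup.Hom B₁ B),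
        (∀ n, IsClosedImmersion (j.app n).left) ∧
          (∀ n, j.app n ≫ ε.app n = j.app n) ∧
          (∀ n ⦃T : Over (Spec (.of A))⦄ (t : T ⟶ B.G n), t ≫ ε.app n = t → ∃! s : T ⟶ B₁.G n, s ≫ j.app n = t) := by
  intro p hp A _ _ h B ε hε
  obtain ⟨h₁, hrank⟩ := ε.exists_finrank_fixLayer_eq_pow hp hε
  exact ⟨h₁, ε.fixBTGroup hε h₁ hrank, ε.fixBTGroupι hε h₁ hrank, fun n => ε.isClosedImmersion_fixLayerι_left n,
    fun n => ε.fixLayerι_comp n, fun n _ t ht => ε.existsUnique_comp_fixLayerι_eq n t ht⟩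

end BTGroup

end Literature.AlgebraicGeometry.GroupSchemes

end

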